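import Summits.MatrixMultiplication.MatrixMultiplication.Theorems.FarEdgeDescentKoszulFloor
import HarnessLib

/-!
# Far-edge descent, kernel XXXIX-G — the Landsberg–Ottaviani floor for WIDE legs

Kernel XXXIX-E gave Landsberg–Ottaviani weight to the blocks of ONE width `p + 1` of a direct sum
`D = ⊕ᵢ ⟨kᵢ,mᵢ,kᵢ⟩` (`lo_floor`: `∑_{kᵢ=1} mᵢ + (2p+1)·∑_{kᵢ=p+1} mᵢ ≤ R̲(D)`).  Here every block
whose width is a MULTIPLE of `p + 1` is weighted: the block projection (`wideProj`) sends
`z_{(i;κ,ν)}` of a block with `(p+1) ∣ kᵢ` to the LO Vandermonde weight `c_j^{(κ mod (p+1)) + (ν mod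
(p+1))}` when `κ, ν` lie in the same diagonal `(p+1) × (p+1)` cell (`⌊κ/(p+1)⌋ = ⌊ν/(p+1)⌋`) and to
`0` otherwise — the Koszul image of the restriction `⟨c(p+1), M, c(p+1)⟩ ≥ ⊕_c ⟨p+1, M, p+1⟩` to the
diagonal cells — and width-`1` blocks to `e₀` as before.  The selected minor is again
`fromBlocks 1 0 0 (blockDiagonal LO-minors)`, now with one LO-minor per (block, cell, inner index):

* `lo_floor_wide_of_nodes`, **`lo_floor_wide`** —
  `∑_{kᵢ=1} mᵢ + (2p+1)·∑_{(p+1) ∣ kᵢ} (kᵢ/(p+1))·mᵢ ≤ R̲(⊕ᵢ ⟨kᵢ,mᵢ,kᵢ⟩)` (`p ≥ 1`), EVERY field;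
* `anchored_lo_floor_wide` — legs of widths `a·dᵢ` (any multiples of `a ≥ 2`):
  **`Q + (2a−1)·∑ dᵢBᵢ ≤ R̲(⟨1,Q,1⟩ ⊕ ⊕ᵢ⟨a dᵢ, Bᵢ, a dᵢ⟩)`**, i.e. `R̲ ≥ Q + (2 − 1/a)·L` with `L` the
  FULL leg mass; `anchored_lo_budget_wide` — a certificate `R̲ ≤ Q + βL` forces `β ≥ 2 − 1/a`.

For the lens (dial model, kernel XXXVIII): every node of a product tower grown from width-`a` bases
has leg widths that are powers of `a`, so `r ≥ Q + (2 − 1/a)L` (and, with `p + 1 = a^j`,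
`r ≥ Q + (2 − a^{−j})·L_{≥j}` for the mass on legs of width divisible by `a^j`) holds at EVERY NODE,
not only at the bases (kernel XXXIX-F).  HONEST FRAMING: the same instantiation of the tree's Koszul
theorem as kernel XXXIX-E with a finer block projection; additive over blocks; no upper bounds;
nothing on `AnchoredLogConvexity`; definitions are a coefficient matrix and index bookkeeping only.
References: Landsberg–Ottaviani, Theory Comput. 11 (2015), Thm. 1.1/2.1 [LandsbergOttaviani2015];
Landsberg, *Geometry and Complexity Theory* (2017), Thm. 2.5.2.6 [Landsberg2017]; BCS 1997, (15.26)
[BurgisserClausenShokrollahi1997].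
-/

noncomputable section

open scoped BigOperators Polynomial
open Matrix Finset

set_option linter.dupNamespace false

namespace Summit.MatrixMultiplication.MatrixMultiplication.Theorems.FarEdgeDescentKoszulFloorWide

open Literature.Computability.AlgebraicComplexity
open Summit.MatrixMultiplication.MatrixMultiplication.Theorems.FarEdgeDescentStrassenFloor (sigma_eq_iff)
open Summit.MatrixMultiplication.MatrixMultiplication.Theorems.FarEdgeDescentKoszulFloor

variable (K : Type) [Field K] {q : ℕ}

/-! ## §1 Entries of the Koszul flattening of the direct sum under any projection matrix -/

/-- `Φ(z_a)` is column `a` of the projection matrix. -/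
theorem proj_single {p : ℕ} {k : Fin q → ℕ}
    (Φm : Matrix (Fin (2 * p + 1)) (Σ i, Fin (k i) × Fin (k i)) K) (a : Σ i, Fin (k i) × Fin (k i)) :
    Φm.mulVecLin (Pi.single a 1) = fun j => Φm j a := by
  ext j
  rw [Matrix.mulVecLin_apply, Matrix.mulVec_single_one]
  rfl

/-- Entry over a non-matching pair (different blocks or inner indices): `0`. -/
theorem entry_zero' (k m : Fin q → ℕ) (p : ℕ)
    (Φm : Matrix (Fin (2 * p + 1)) (Σ i, Fin (k i) × Fin (k i)) K)
    (T : PSub (2 * p + 1) (p + 1)) (S : PSub (2 * p + 1) p) (x : Σ i, Fin (k i) × Fin (m i))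
    (y : Σ i, Fin (m i) × Fin (k i)) (h : ¬ (x.1 = y.1 ∧ (x.2.2 : ℕ) = y.2.1)) :
    koszulFlattening p Φm.mulVecLin (matMulDirectSum K k m k) (T, y) (S, x) = 0 := by
  show wedgeMatrix (Φm.mulVecLin fun a => matMulDirectSum K k m k a x y) T.1 S.1 = 0
  rw [fibre_zero K k m x y h, map_zero, wedgeMatrix_zero]
  rfl

/-- Entry over a matching pair `x = (i;κ,μ)`, `y = (i;μ,ν)`: `(Φ(z_{(i;κ,ν)}) ∧ e_S)_T`. -/
theorem entry_same' (k m : Fin q → ℕ) (p : ℕ)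
    (Φm : Matrix (Fin (2 * p + 1)) (Σ i, Fin (k i) × Fin (k i)) K)
    (T : PSub (2 * p + 1) (p + 1)) (S : PSub (2 * p + 1) p) (i : Fin q) (κ ν : Fin (k i))
    (μ : Fin (m i)) :
    koszulFlattening p Φm.mulVecLin (matMulDirectSum K k m k) (T, ⟨i, (μ, ν)⟩) (S, ⟨i, (κ, μ)⟩) =
      wedgeMatrix (fun j => Φm j ⟨i, (κ, ν)⟩) T.1 S.1 := by
  show wedgeMatrix (Φm.mulVecLin fun a => matMulDirectSum K k m k a ⟨i, (κ, μ)⟩ ⟨i, (μ, ν)⟩) T.1 S.1 = _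
  rw [fibre_same K k m i κ ν μ, proj_single]

/-! ## §2 The wide block projection -/

/-- The wide block projection: a width-`1` block goes to `e₀`; in any other block, `z_{(i;κ,ν)}` goes
to `c_j^{(κ mod (p+1)) + (ν mod (p+1))}` if `κ, ν` lie in the same diagonal `(p+1) × (p+1)` cell and to
`0` otherwise. -/
def wideProj (k : Fin q → ℕ) (p : ℕ) (c : Fin (2 * p + 1) → K) :
    Matrix (Fin (2 * p + 1)) (Σ i, Fin (k i) × Fin (k i)) K :=
  Matrix.of fun j a => if k a.1 = 1 then (Pi.single (0 : Fin (2 * p + 1)) (1 : K) : Fin (2 * p + 1) → K) j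
    else if (a.2.1 : ℕ) / (p + 1) = (a.2.2 : ℕ) / (p + 1) then
      c j ^ ((a.2.1 : ℕ) % (p + 1) + (a.2.2 : ℕ) % (p + 1)) else 0

/-! ## §3 Labels: (block with `(p+1) ∣ kᵢ`, diagonal cell, inner index) -/

variable {K}

/-- Labels of the LO rows/columns: a block of width divisible by `p + 1`, a diagonal cell, an inner
index. -/
abbrev WIdx (k m : Fin q → ℕ) (p : ℕ) : Type :=
  Σ i : {i : Fin q // (p + 1) ∣ k i}, Fin (k i.1 / (p + 1)) × Fin (m i.1)

/-- Equality of labels. -/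
theorem wIdx_eq_iff {k m : Fin q → ℕ} {p : ℕ} (u u' : WIdx k m p) :
    u = u' ↔ u.1.1 = u'.1.1 ∧ (u.2.1 : ℕ) = u'.2.1 ∧ (u.2.2 : ℕ) = u'.2.2 := by
  refine ⟨by rintro rfl; exact ⟨rfl, rfl, rfl⟩, fun ⟨h1, h2, h3⟩ => ?_⟩
  obtain ⟨⟨i, hi⟩, γ, μ⟩ := u
  obtain ⟨⟨i', hi'⟩, γ', μ'⟩ := u'
  simp only at h1 h2 h3
  subst h1
  obtain rfl : γ = γ' := Fin.ext h2
  obtain rfl : μ = μ' := Fin.ext h3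
  rfl

/-- The outer index `γ·(p+1) + ν` of cell `γ`, position `ν`. -/
def emb {k : Fin q → ℕ} {p : ℕ} (i : {i : Fin q // (p + 1) ∣ k i}) (γ : Fin (k i.1 / (p + 1)))
    (ν : Fin (p + 1)) : Fin (k i.1) :=
  ⟨(γ : ℕ) * (p + 1) + ν, by
    have h1 : ((γ : ℕ) + 1) * (p + 1) ≤ k i.1 / (p + 1) * (p + 1) := Nat.mul_le_mul_right _ γ.2
    rw [Nat.div_mul_cancel i.2, add_mul, one_mul] at h1
    have := ν.2
    omega⟩

/-- The cell of `γ·(p+1) + ν` is `γ`. -/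
theorem emb_div {k : Fin q → ℕ} {p : ℕ} (i : {i : Fin q // (p + 1) ∣ k i})
    (γ : Fin (k i.1 / (p + 1))) (ν : Fin (p + 1)) : (emb i γ ν : ℕ) / (p + 1) = γ := by
  show ((γ : ℕ) * (p + 1) + ν) / (p + 1) = γ
  rw [Nat.add_comm, Nat.add_mul_div_right _ _ (Nat.succ_pos p), Nat.div_eq_of_lt ν.2, zero_add]

/-- The position of `γ·(p+1) + ν` inside its cell is `ν`. -/
theorem emb_mod {k : Fin q → ℕ} {p : ℕ} (i : {i : Fin q // (p + 1) ∣ k i})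
    (γ : Fin (k i.1 / (p + 1))) (ν : Fin (p + 1)) : (emb i γ ν : ℕ) % (p + 1) = ν := by
  show ((γ : ℕ) * (p + 1) + ν) % (p + 1) = ν
  rw [Nat.add_comm, Nat.add_mul_mod_self_right, Nat.mod_eq_of_lt ν.2]

/-- A block of width divisible by `p + 1 ≥ 2` is not a width-`1` block. -/
theorem ne_one_of_dvd {k : Fin q → ℕ} {p : ℕ} (hp : 1 ≤ p) (i : {i : Fin q // (p + 1) ∣ k i})
    (γ : Fin (k i.1 / (p + 1))) : ¬ k i.1 = 1 := by
  intro h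
  have h1 := γ.2
  have h2 : k i.1 / (p + 1) = 0 := by
    rw [h]; exact Nat.div_eq_of_lt (by omega)
  omega

/-- Row selection: anchor rows `({0} ∪ (S+1), (i;μ,0))`, LO rows `(T, (i;μ,γ(p+1)+ν))`. -/
def rowSelW (k m : Fin q → ℕ) (p : ℕ) :
    (PSub (2 * p) p × UnitIdx k m) ⊕ ((PSub (2 * p + 1) (p + 1) × Fin (p + 1)) × WIdx k m p) →
      PSub (2 * p + 1) (p + 1) × (Σ i, Fin (m i) × Fin (k i)) :=
  Sum.elim (fun x => (lift0 x.1, ⟨x.2.1.1, (x.2.2, uz x.2.1)⟩))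
    (fun x => (x.1.1, ⟨x.2.1.1, (x.2.2.2, emb x.2.1 x.2.2.1 x.1.2)⟩))

/-- Column selection: anchor columns `(S+1, (i;0,μ))`, LO columns
`(ε(T,ν).1, (i; γ(p+1)+ε(T,ν).2, μ))` for a column matching `ε` of the reduced flattening. -/
def colSelW (k m : Fin q → ℕ) (p : ℕ)
    (ε : PSub (2 * p + 1) (p + 1) × Fin (p + 1) → PSub (2 * p + 1) p × Fin (p + 1)) :
    (PSub (2 * p) p × UnitIdx k m) ⊕ ((PSub (2 * p + 1) (p + 1) × Fin (p + 1)) × WIdx k m p) →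
      PSub (2 * p + 1) p × (Σ i, Fin (k i) × Fin (m i)) :=
  Sum.elim (fun x => (liftS x.1, ⟨x.2.1.1, (uz x.2.1, x.2.2)⟩))
    (fun x => ((ε x.1).1, ⟨x.2.1.1, (emb x.2.1 x.2.2.1 (ε x.1).2, x.2.2.2)⟩))

variable (K)

/-- **The selected submatrix is block diagonal**: identity on the anchor labels, one copy of the
`ε`-minor of the reduced Landsberg–Ottaviani flattening per (block, cell, inner index).
[cite: Landsberg2017, §2.5.2, Thm. 2.5.2.6 (proof)] -/
theorem submatrix_koszul_eq_wide (k m : Fin q → ℕ) (p : ℕ) (hp : 1 ≤ p) (c : Fin (2 * p + 1) → K)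
    (ΦLO : (Fin (p + 1) × Fin (p + 1) → K) →ₗ[K] (Fin (2 * p + 1) → K))
    (hΦLO : ∀ (κ ν : Fin (p + 1)) (j : Fin (2 * p + 1)),
      ΦLO (Pi.single (κ, ν) 1) j = c j ^ ((κ : ℕ) + ν))
    (ε : PSub (2 * p + 1) (p + 1) × Fin (p + 1) → PSub (2 * p + 1) p × Fin (p + 1)) :
    (koszulFlattening p (wideProj K k p c).mulVecLin (matMulDirectSum K k m k)).submatrix
        (rowSelW k m p) (colSelW k m p ε) =
      Matrix.fromBlocks 1 0 0
        (Matrix.blockDiagonal fun _ : WIdx k m p =>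
          (matMulKoszulMatrix (p + 1) p ΦLO).submatrix id ε) := by
  classical
  ext (x | x) (x' | x')
  · obtain ⟨S₁, ⟨⟨i, hi⟩, μ⟩⟩ := x
    obtain ⟨S₂, ⟨⟨i', hi'⟩, μ'⟩⟩ := x'
    rw [Matrix.submatrix_apply, Matrix.fromBlocks_apply₁₁, Matrix.one_apply]
    simp only [rowSelW, colSelW, Sum.elim_inl]
    by_cases h : i = i' ∧ (μ : ℕ) = μ'
    · obtain ⟨rfl, hμ⟩ := h
      obtain rfl : μ = μ' := Fin.ext hμ
      rw [entry_same']
      have hlo : (fun j => wideProj K k p c j ⟨i, (uz ⟨i, hi'⟩, uz ⟨i, hi⟩)⟩) =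
          Pi.single (0 : Fin (2 * p + 1)) (1 : K) := by
        funext j
        simp [wideProj, hi]
      rw [hlo, wedge_unit]
      by_cases hS : S₁ = S₂
      · subst hS
        simp
      · rw [if_neg hS, if_neg fun hx => hS (congrArg Prod.fst hx)]
    · rw [entry_zero' K k m p _ _ _ _ _ fun h' => h ⟨h'.1.symm, h'.2.symm⟩, if_neg]
      intro hx
      have h2 := (sigmaSub_eq_iff _ _).1 (congrArg Prod.snd hx)
      exact h ⟨h2.1, h2.2⟩
  · obtain ⟨S₁, ⟨⟨i, hi⟩, μ⟩⟩ := x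
    obtain ⟨⟨T', ν'⟩, ⟨⟨i', hi'⟩, γ', μ'⟩⟩ := x'
    rw [Matrix.submatrix_apply, Matrix.fromBlocks_apply₁₂, Matrix.zero_apply]
    simp only [rowSelW, colSelW, Sum.elim_inl, Sum.elim_inr]
    refine entry_zero' K k m p _ _ _ _ _ ?_
    rintro ⟨h1, -⟩
    have hne : ¬ k i' = 1 := ne_one_of_dvd hp ⟨i', hi'⟩ γ'
    change i' = i at h1
    subst h1
    exact hne hi
  · obtain ⟨⟨T, ν⟩, ⟨⟨i, hi⟩, γ, μ⟩⟩ := x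
    obtain ⟨S₂, ⟨⟨i', hi'⟩, μ'⟩⟩ := x'
    rw [Matrix.submatrix_apply, Matrix.fromBlocks_apply₂₁, Matrix.zero_apply]
    simp only [rowSelW, colSelW, Sum.elim_inl, Sum.elim_inr]
    refine entry_zero' K k m p _ _ _ _ _ ?_
    rintro ⟨h1, -⟩
    have hne : ¬ k i = 1 := ne_one_of_dvd hp ⟨i, hi⟩ γ
    change i' = i at h1
    subst h1
    exact hne hi'
  · obtain ⟨⟨T, ν⟩, ⟨⟨i, hi⟩, γ, μ⟩⟩ := x
    obtain ⟨⟨T', ν'⟩, ⟨⟨i', hi'⟩, γ', μ'⟩⟩ := x'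
    rw [Matrix.submatrix_apply, Matrix.fromBlocks_apply₂₂, Matrix.blockDiagonal_apply]
    simp only [rowSelW, colSelW, Sum.elim_inr]
    by_cases h : i = i' ∧ (μ : ℕ) = μ'
    · obtain ⟨rfl, hμ⟩ := h
      obtain rfl : μ = μ' := Fin.ext hμ
      rw [entry_same']
      have hne : ¬ k i = 1 := ne_one_of_dvd hp ⟨i, hi⟩ γ
      by_cases hγ : γ = γ'
      · subst hγ
        rw [if_pos rfl, Matrix.submatrix_apply, id, matMulKoszulMatrix_apply]
        congr 1
        funext j
        rw [hΦLO]
        simp [wideProj, hne, emb_div, emb_mod]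
      · have hw : (fun j => wideProj K k p c j
            ⟨i, (emb ⟨i, hi'⟩ γ' (ε (T', ν')).2, emb ⟨i, hi⟩ γ ν)⟩) = 0 := by
          funext j
          have hγ' : ¬ ((emb ⟨i, hi'⟩ γ' (ε (T', ν')).2 : ℕ) / (p + 1) =
              (emb ⟨i, hi⟩ γ ν : ℕ) / (p + 1)) := by
            rw [emb_div, emb_div]
            exact fun e => hγ (Fin.ext e).symm
          simp [wideProj, hne, hγ']
        rw [hw, wedgeMatrix_zero, if_neg]
        · rfl
        · intro hx
          have h2 := (wIdx_eq_iff _ _).1 hx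
          exact hγ (Fin.ext h2.2.1)
    · rw [entry_zero' K k m p _ _ _ _ _ fun h' => h ⟨h'.1.symm, h'.2.symm⟩, if_neg]
      intro hx
      have h2 := (wIdx_eq_iff _ _).1 hx
      exact h ⟨h2.1, h2.2.2⟩

/-! ## §4 The floor -/

/-- `|WIdx| = ∑_{(p+1) ∣ kᵢ} (kᵢ/(p+1))·mᵢ`. -/
theorem card_wIdx (k m : Fin q → ℕ) (p : ℕ) :
    Fintype.card (WIdx k m p) =
      ∑ i ∈ univ.filter (fun i => (p + 1) ∣ k i), k i / (p + 1) * m i := by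
  rw [Fintype.card_sigma,
    Finset.sum_subtype (p := fun i => (p + 1) ∣ k i) (F := inferInstance)
      (univ.filter fun i => (p + 1) ∣ k i) (fun i => by simp) (fun i => k i / (p + 1) * m i)]
  simp only [Fintype.card_prod, Fintype.card_fin]

set_option synthInstance.maxSize 512 in
/-- **The wide Landsberg–Ottaviani floor, over a field with `2p+1` distinct nodes:**
`∑_{kᵢ=1} mᵢ + (2p+1)·∑_{(p+1) ∣ kᵢ} (kᵢ/(p+1))·mᵢ ≤ R̲(⊕ᵢ ⟨kᵢ,mᵢ,kᵢ⟩)` (`p ≥ 1`).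
[cite: LandsbergOttaviani2015, Thm 1.1, Thm 2.1] [cite: Landsberg2017, §2.5.2, Thm. 2.5.2.6] -/
theorem lo_floor_wide_of_nodes (k m : Fin q → ℕ) (p : ℕ) (hp : 1 ≤ p) (c : Fin (2 * p + 1) → K)
    (hc : Function.Injective c) :
    (∑ i ∈ univ.filter (fun i => k i = 1), m i) +
        (2 * p + 1) * ∑ i ∈ univ.filter (fun i => (p + 1) ∣ k i), k i / (p + 1) * m i ≤
      algBorderRank (matMulDirectSum K k m k) := by
  set ΦLO : (Fin (p + 1) × Fin (p + 1) → K) →ₗ[K] (Fin (2 * p + 1) → K) :=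
    (Matrix.of fun (j : Fin (2 * p + 1)) (a : Fin (p + 1) × Fin (p + 1)) =>
      c j ^ ((a.1 : ℕ) + a.2)).mulVecLin with hΦLOdef
  have hΦLO : ∀ (κ ν : Fin (p + 1)) (j : Fin (2 * p + 1)),
      ΦLO (Pi.single (κ, ν) 1) j = c j ^ ((κ : ℕ) + ν) := by
    intro κ ν j
    simp [hΦLOdef, Matrix.mulVec, dotProduct, Pi.single_apply]
  have hcard : Fintype.card (PSub (2 * p + 1) (p + 1) × Fin (p + 1)) =
      Fintype.card (PSub (2 * p + 1) p × Fin (p + 1)) := by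
    simp only [Fintype.card_prod, card_PSub, Fintype.card_fin, Nat.choose_symm_half]
  obtain ⟨ε, hε⟩ := exists_det_submatrix_ne_zero_of_injective _ hcard
    (matMulKoszulMatrix_injective_of_nodes p c hc ΦLO hΦLO)
  set M := koszulFlattening p (wideProj K k p c).mulVecLin (matMulDirectSum K k m k) with hMdef
  have hsub := submatrix_koszul_eq_wide K k m p hp c ΦLO hΦLO ε
  have hdet : (M.submatrix (rowSelW k m p) (colSelW k m p ε)).det ≠ 0 := by
    rw [hMdef, hsub, Matrix.det_fromBlocks_zero₂₁, Matrix.det_one, one_mul,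
      Matrix.det_blockDiagonal]
    exact Finset.prod_ne_zero_iff.2 fun _ _ => hε
  set X := (PSub (2 * p) p × UnitIdx k m) ⊕
    ((PSub (2 * p + 1) (p + 1) × Fin (p + 1)) × WIdx k m p) with hX
  let e : Fin (Fintype.card X) ≃ X := (Fintype.equivFin X).symm
  have hdet' : (M.submatrix (rowSelW k m p ∘ e) (colSelW k m p ε ∘ e)).det ≠ 0 := by
    rw [show M.submatrix (rowSelW k m p ∘ e) (colSelW k m p ε ∘ e) =
        (M.submatrix (rowSelW k m p) (colSelW k m p ε)).submatrix e e from rfl,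
      Matrix.det_submatrix_equiv_self]
    exact hdet
  have hk := Matrix.le_rank_of_isUnit_det_submatrix _ (rowSelW k m p ∘ e) (colSelW k m p ε ∘ e)
    (isUnit_iff_ne_zero.2 hdet')
  have h2 := LandsbergOttaviani2015_thm21_algBorderRank p (wideProj K k p c).mulVecLin
    (matMulDirectSum K k m k)
  have h12 := hk.trans h2
  have hcardX : Fintype.card X = (2 * p).choose p * Fintype.card (UnitIdx k m) +
      (2 * p + 1).choose (p + 1) * (p + 1) * Fintype.card (WIdx k m p) := by
    simp only [hX, Fintype.card_sum, Fintype.card_prod, card_PSub, Fintype.card_fin]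
  have hid : (2 * p + 1).choose (p + 1) * (p + 1) = (2 * p + 1) * (2 * p).choose p :=
    (Nat.add_one_mul_choose_eq (2 * p) p).symm
  have hpos : 0 < (2 * p).choose p := Nat.choose_pos (by omega)
  rw [← card_unitIdx, ← card_wIdx]
  refine Nat.le_of_mul_le_mul_left ?_ hpos
  calc (2 * p).choose p * (Fintype.card (UnitIdx k m) + (2 * p + 1) * Fintype.card (WIdx k m p))
      = (2 * p).choose p * Fintype.card (UnitIdx k m) +
          (2 * p + 1).choose (p + 1) * (p + 1) * Fintype.card (WIdx k m p) := by rw [hid]; ring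
    _ = Fintype.card X := hcardX.symm
    _ ≤ _ := h12

/-- **The wide Landsberg–Ottaviani floor over EVERY field**:
`∑_{kᵢ=1} mᵢ + (2p+1)·∑_{(p+1) ∣ kᵢ} (kᵢ/(p+1))·mᵢ ≤ R̲(⊕ᵢ ⟨kᵢ,mᵢ,kᵢ⟩)` (`p ≥ 1`).
[cite: LandsbergOttaviani2015, Thm 1.1] [cite: BurgisserClausenShokrollahi1997, (15.26)] -/
theorem lo_floor_wide (k m : Fin q → ℕ) (p : ℕ) (hp : 1 ≤ p) :
    (∑ i ∈ univ.filter (fun i => k i = 1), m i) +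
        (2 * p + 1) * ∑ i ∈ univ.filter (fun i => (p + 1) ∣ k i), k i / (p + 1) * m i ≤
      algBorderRank (matMulDirectSum K k m k) := by
  classical
  let Lf := FractionRing K[X]
  let f : K →+* Lf := (algebraMap K[X] Lf).comp Polynomial.C
  have hmap : algBorderRank (matMulDirectSum Lf k m k) ≤ algBorderRank (matMulDirectSum K k m k) := by
    rw [← matMulDirectSum_map K f k m k]
    exact algBorderRank_map_le f _
  refine le_trans ?_ hmap
  set x : Lf := algebraMap K[X] Lf Polynomial.X with hx
  have hc : Function.Injective (fun j : Fin (2 * p + 1) => x ^ (j : ℕ)) := by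
    intro i j h
    apply Fin.ext
    simp only at h
    rw [hx, ← map_pow, ← map_pow] at h
    have h' := IsFractionRing.injective K[X] Lf h
    have := congrArg Polynomial.natDegree h'
    rwa [Polynomial.natDegree_X_pow, Polynomial.natDegree_X_pow] at this
  exact lo_floor_wide_of_nodes Lf k m p hp (fun j => x ^ (j : ℕ)) hc

/-! ## §5 Anchored objects with legs of widths `a·dᵢ`: `R̲ ≥ Q + (2 − 1/a)·L`, `β ≥ 2 − 1/a` -/

/-- **Anchored floor, legs of any widths divisible by `a`:**
`Q + (2a−1)·∑ dᵢBᵢ ≤ R̲(⟨1,Q,1⟩ ⊕ ⊕ᵢ⟨a dᵢ, Bᵢ, a dᵢ⟩)` (`a ≥ 2`) — with `L = ∑ (a dᵢ) Bᵢ` the full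
leg mass this is `R̲ ≥ Q + (2 − 1/a)·L`. [cite: LandsbergOttaviani2015, Thm 1.1] -/
theorem anchored_lo_floor_wide {c : ℕ} (a Q : ℕ) (d B : Fin c → ℕ) (ha : 2 ≤ a) :
    Q + (2 * a - 1) * ∑ i, d i * B i ≤
      algBorderRank (matMulDirectSum K (Fin.cons 1 fun i => a * d i) (Fin.cons Q B)
        (Fin.cons 1 fun i => a * d i)) := by
  classical
  obtain ⟨p, rfl⟩ : ∃ p, a = p + 1 := ⟨a - 1, by omega⟩
  have h := lo_floor_wide K (Fin.cons 1 fun i => (p + 1) * d i) (Fin.cons Q B) p (by omega)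
  have h1 : ¬ (p + 1 ∣ 1) := by
    intro hd
    have := Nat.le_of_dvd Nat.one_pos hd
    omega
  simp only [Finset.sum_filter, Fin.sum_univ_succ, Fin.cons_zero, Fin.cons_succ, if_true, h1,
    if_false, zero_add, Dvd.intro _ rfl, Nat.mul_div_cancel_left _ (show 0 < p + 1 by omega)] at h
  have h0 : 0 ≤ ∑ i : Fin c, (if (p + 1) * d i = 1 then B i else 0) := Nat.zero_le _
  have h21 : 2 * (p + 1) - 1 = 2 * p + 1 := by omega
  rw [h21]
  omega

/-- **The budget factor for legs of widths divisible by `a`: `β ≥ 2 − 1/a`** — a certificate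
`R̲(⟨1,Q,1⟩ ⊕ ⊕ᵢ⟨a dᵢ,Bᵢ,a dᵢ⟩) ≤ Q + β·L`, `L = ∑ᵢ (a dᵢ)Bᵢ > 0`, has `2 − 1/a ≤ β`, over every field
and every anchor.  (Every node of a product tower grown from width-`a` bases is of this form.)
[cite: LandsbergOttaviani2015, Thm 1.1] -/
theorem anchored_lo_budget_wide {c : ℕ} (a Q : ℕ) (d B : Fin c → ℕ) (ha : 2 ≤ a)
    (hL : 0 < ∑ i, d i * B i) {β : ℝ}
    (h : (algBorderRank (matMulDirectSum K (Fin.cons 1 fun i => a * d i) (Fin.cons Q B)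
        (Fin.cons 1 fun i => a * d i)) : ℝ) ≤ Q + β * ∑ i, ((a * d i * B i : ℕ) : ℝ)) :
    2 - 1 / (a : ℝ) ≤ β := by
  have hf := anchored_lo_floor_wide K a Q d B ha
  have hf' : ((Q + (2 * a - 1) * ∑ i, d i * B i : ℕ) : ℝ) ≤
      Q + β * ∑ i, ((a * d i * B i : ℕ) : ℝ) := le_trans (by exact_mod_cast hf) h
  have hS : (0 : ℝ) < ((∑ i, d i * B i : ℕ) : ℝ) := by exact_mod_cast hL
  have ha' : (0 : ℝ) < a := by exact_mod_cast (show 0 < a by omega)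
  have h21 : ((2 * a - 1 : ℕ) : ℝ) = 2 * a - 1 := by
    rw [Nat.cast_sub (by omega)]
    push_cast
    ring
  have hsum : ∑ i, ((a * d i * B i : ℕ) : ℝ) = (a : ℝ) * ((∑ i, d i * B i : ℕ) : ℝ) := by
    push_cast
    rw [Finset.mul_sum]
    refine Finset.sum_congr rfl fun i _ => ?_
    ring
  rw [hsum] at hf'
  push_cast at hf' hS
  rw [h21] at hf'
  set S := ∑ i, ((d i : ℝ) * (B i : ℝ))
  have hkey : (2 * (a : ℝ) - 1) * S ≤ β * ((a : ℝ) * S) := by linarith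
  have hdiv : 2 * (a : ℝ) - 1 ≤ β * a := by
    have := div_le_div_of_nonneg_right hkey hS.le
    rwa [mul_div_assoc, div_self hS.ne', mul_one, ← mul_assoc, mul_div_assoc, div_self hS.ne',
      mul_one] at this
  have hmul : (2 - 1 / (a : ℝ)) * a ≤ β * a := by
    rw [sub_mul, div_mul_cancel₀ _ ha'.ne']
    linarith
  exact le_of_mul_le_mul_right hmul ha'

end Summit.MatrixMultiplication.MatrixMultiplication.Theorems.FarEdgeDescentKoszulFloorWide
end
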